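import Summits.HubbardSuperconductivity.HubbardSuperconductivity.Theorems.JmInterchange.Negative.AbstractWindowInterchangeFalse

/-!
# The residue (R2′) `FloorOrderBridges` of `JosephsonMirror.JmInterchange` (stmt-HubbardSuperconductivity-2227) is false
WITHOUT Hubbard specifics — negative-side support (lead c4): floor order, Koma–Tasaki locality budget and linear Josephson gain,
yet NO floor bridge (a tower collision at the Koma–Tasaki scale `L⁻²`)

By the tree's exact normal form `jmInterchange_iff_reachesFloor_and_bridges` (p127245) the crux is `(R1) ∧ (R2′)` with
(R2′) `FloorOrderBridges : ∀ (U, δ), FloorOrder U δ → FloorBridge U δ` — ground-floor `d`-wave order of `(N_L, 0)`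
is `Δ_d`-connected to the `(N_L − 2, 0)` floor (registered stub `stub_floorOrderBridges`; c1's worker: `stub-blocked`, no
lower bound on the `(N_L − 2, 0)` spectrum as seen by `Δ_d G(N_L)`).  The sufficient condition the tree owns is the engine
`bridgeFromFloorOrder` (p107506): low-lying orthogonality at a scale `γ_L` with `γ_L L² → ∞` plus the charging floor.

This file records, kernel-checked and with NO new definitions (file-local notation), an abstract layer in the crux's exact
vocabulary that has FLOOR ORDER `‖Δ_L g‖² = L⁴`, obeys the Koma–Tasaki / Horsch–von der Linden LOCALITY BUDGET "the pair
image of the floor has excess energy `≤ C L² ‖g‖²`" (the only model input of `bridgeFromFloorOrder` besides the scale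
hypothesis), has BALANCED floors, Hermitian block-diagonal `A_L`, block-lowering `Δ_L` with `‖Δ_L v‖² ≤ L⁴‖v‖²`, even the
crux's linear Josephson GAIN for every `J > 0` — and NO floor bridge at any `L`: the pair image of the floor lands on an
excited level at the Koma–Tasaki scale `L⁻²` above the adjacent floor (a "tower collision").  So (R2′) — like (R1), see
`AbstractWindowInterchangeFalse.lean` — is not decided by the structure the route's tools see; the missing input is isolation
of the `(N_L − 2, 0)` floor from `Δ_d G(N_L)` at a scale `≫ L⁻²`, i.e. floor-level spectral information about
`hubbardTorus 2 L 1 U` (strategist census `Cruxes/JmInterchange/STRATEGY-CENSUS.md` §1, Adv₂; NegativeNotesTriager2).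

THE TOY (`ℂ³`, side `L ≥ 1`).  `e₀` = block 1 ("`N`"), `e₁, e₂` = block 2 ("`N − 2`"); `A_L = diag(0, 0, L⁻²)`;
`Δ_L = L² |e₂⟩⟨e₀|`.
* `af_floorOrder` : the block-1 floor `e₀` has `‖Δ_L e₀‖² = L⁴`;
* `af_ktBudget` : `Re⟨Δ_L g, A_L Δ_L g⟩ − e₂ ‖Δ_L g‖² = L² |g 0|² ≤ L² ‖g‖²` for every `g` (`e₂ = 0` the block-2 floor
  energy) — the double-commutator budget of KT Theorem 2.2 in the form used by `bridgeFromFloorOrder`;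
* `af_gain` : `J L² − L⁻² ≤ E_L(0) − E_L(J)` (`J ≥ 0`; tree `stub_gainAbstract` with the pair `(e₀, e₂)`), so the crux's
  gain hypothesis holds as well;
* `af_bridge_eq_zero` : `⟨χ, Δ_L φ⟩ = 0` for every block-2 floor vector `χ` and EVERY `φ` — bridge `≡ 0`;
* `not_abstractFloorOrderBridges` : the abstract form of (R2′) (with the locality budget among the hypotheses) is FALSE.

Sources: T. Koma, H. Tasaki, J. Stat. Phys. 76 (1994) 745, Thm 2.2 and §3.4 (the locality budget; the tower); P. Horsch,
W. von der Linden, Z. Phys. B 72 (1988) 181; H. Tasaki, J. Stat. Phys. 174 (2019) 735 §5; E. H. Lieb, PRL 62 (1989) 1201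
(the `W`-matrix packaging).  Elementary finite-dimensional linear algebra over the landed `stub_gainAbstract` (and `aw_le_minEnergyOn` of the sibling file
`AbstractWindowInterchangeFalse.lean`, the (R1)-shape counter-model). [folklore]
-/

noncomputable section

namespace Summit.HubbardSuperconductivity.JmInterchangeNegative

open Matrix Literature.MathematicalPhysics.QuantumLattice
open Summit.HubbardSuperconductivity.HubbardSuperconductivity.Theorems.JosephsonMirror

/-- Toy layer Hamiltonian at side `L`: `diag(0, 0, L⁻²)` on `ℂ³`. -/
local notation "afA[" L "]" =>
  (Matrix.diagonal ![(0 : ℂ), 0, ((((L : ℕ) : ℂ)) ^ 2)⁻¹] : Matrix (Fin 3) (Fin 3) ℂ)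
/-- Toy pair operator at side `L`: `Δ_L = L² |e₂⟩⟨e₀|`. -/
local notation "afΔ[" L "]" => (Matrix.single (2 : Fin 3) (0 : Fin 3) (((L : ℕ) : ℂ) ^ 2) : Matrix (Fin 3) (Fin 3) ℂ)
/-- Block-1 subspace (coordinate `0`). -/
local notation "afK₁" => (⨅ (s : Fin 3) (_ : ¬ (s : ℕ) < 1),
  LinearMap.ker (LinearMap.proj (R := ℂ) (φ := fun _ : Fin 3 => ℂ) s) : Submodule ℂ (Fin 3 → ℂ))
/-- Block-2 subspace (coordinates `1, 2`). -/
local notation "afK₂" => (⨅ (s : Fin 3) (_ : ¬ 1 ≤ (s : ℕ)),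
  LinearMap.ker (LinearMap.proj (R := ℂ) (φ := fun _ : Fin 3 => ℂ) s) : Submodule ℂ (Fin 3 → ℂ))

/-! ### The layer -/

/-- The toy layer Hamiltonian is Hermitian (real diagonal). [folklore] -/
theorem af_isHermitian (L : ℕ) : (afA[L]).IsHermitian := by
  rw [Matrix.IsHermitian, Matrix.diagonal_conjTranspose]
  congr 1
  ext i
  fin_cases i <;> simp

/-- Action of the toy layer Hamiltonian. [folklore] -/
theorem af_mulVec (L : ℕ) (v : Fin 3 → ℂ) : afA[L] *ᵥ v = ![0, 0, (((L : ℂ)) ^ 2)⁻¹ * v 2] := by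
  ext i
  fin_cases i <;> simp [Matrix.mulVec_diagonal]

/-- Rayleigh quotient of the toy layer Hamiltonian: `Re⟨v, A_L v⟩ = L⁻² |v 2|²`. [folklore] -/
theorem af_re_rayleigh (L : ℕ) (v : Fin 3 → ℂ) :
    (star v ⬝ᵥ afA[L] *ᵥ v).re = ((L : ℝ) ^ 2)⁻¹ * ‖v 2‖ ^ 2 := by
  rw [af_mulVec]
  have h : star v ⬝ᵥ ![0, 0, (((L : ℂ)) ^ 2)⁻¹ * v 2] = (((L : ℂ)) ^ 2)⁻¹ * ((starRingEnd ℂ) (v 2) * v 2) := by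
    simp [dotProduct, Fin.sum_univ_three]
    ring
  rw [h, Complex.conj_mul', ← Complex.ofReal_pow, ← Complex.ofReal_natCast, ← Complex.ofReal_pow,
    ← Complex.ofReal_inv, ← Complex.ofReal_mul, Complex.ofReal_re]

/-- `‖v‖² = Σ |v i|²` on `ℂ³`. [folklore] -/
theorem af_re_star_dotProduct_self (v : Fin 3 → ℂ) :
    (star v ⬝ᵥ v).re = ‖v 0‖ ^ 2 + ‖v 1‖ ^ 2 + ‖v 2‖ ^ 2 := by
  simp only [Complex.sq_norm, Complex.normSq_apply]
  simp [dotProduct, Fin.sum_univ_three, Complex.mul_re]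

/-- The toy layer Hamiltonian is nonnegative. [folklore] -/
theorem af_rayleigh_nonneg (L : ℕ) (v : Fin 3 → ℂ) : 0 ≤ (star v ⬝ᵥ afA[L] *ᵥ v).re := by
  rw [af_re_rayleigh]; positivity

/-- Membership in the block-1 subspace: support in `{0}`. [folklore] -/
theorem af_mem_K₁ (v : Fin 3 → ℂ) : v ∈ afK₁ ↔ ∀ s : Fin 3, ¬ (s : ℕ) < 1 → v s = 0 := by
  simp only [Submodule.mem_iInf, LinearMap.mem_ker, LinearMap.proj_apply]

/-- Membership in the block-2 subspace: support in `{1, 2}`. [folklore] -/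
theorem af_mem_K₂ (v : Fin 3 → ℂ) : v ∈ afK₂ ↔ ∀ s : Fin 3, ¬ 1 ≤ (s : ℕ) → v s = 0 := by
  simp only [Submodule.mem_iInf, LinearMap.mem_ker, LinearMap.proj_apply]

/-- The toy layer Hamiltonian preserves block 1. [folklore] -/
theorem af_mulVec_mem_K₁ (L : ℕ) {v : Fin 3 → ℂ} (hv : v ∈ afK₁) : afA[L] *ᵥ v ∈ afK₁ := by
  rw [af_mem_K₁] at hv ⊢
  intro s hs
  rw [af_mulVec]
  fin_cases s
  · exact absurd (by decide) hs
  · rfl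
  · simp [hv 2 (by decide)]

/-- The toy layer Hamiltonian maps into block 2 (in particular it preserves block 2). [folklore] -/
theorem af_mulVec_mem_K₂ (L : ℕ) (v : Fin 3 → ℂ) : afA[L] *ᵥ v ∈ afK₂ := by
  rw [af_mem_K₂]
  intro s hs
  rw [af_mulVec]
  fin_cases s
  · rfl
  · exact absurd (by decide) hs
  · exact absurd (by decide) hs

/-- `e_i` is a unit vector. [folklore] -/
theorem af_single_unit (i : Fin 3) : star (Pi.single i (1 : ℂ)) ⬝ᵥ Pi.single i (1 : ℂ) = 1 := by
  rw [← Pi.single_star, star_one, single_dotProduct, one_mul, Pi.single_eq_same]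

/-- `e₀` lies in block 1. [folklore] -/
theorem af_single_mem_K₁ : (Pi.single (0 : Fin 3) (1 : ℂ) : Fin 3 → ℂ) ∈ afK₁ := by
  rw [af_mem_K₁]
  intro s hs
  rw [Pi.single_apply, if_neg]
  rintro rfl
  exact hs (by decide)

/-- `e₁, e₂` lie in block 2. [folklore] -/
theorem af_single_mem_K₂ {i : Fin 3} (hi : 1 ≤ (i : ℕ)) : (Pi.single i (1 : ℂ) : Fin 3 → ℂ) ∈ afK₂ := by
  rw [af_mem_K₂]
  intro s hs
  rw [Pi.single_apply, if_neg]
  rintro rfl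
  exact hs hi

/-- Rayleigh quotients of `e₀` and `e₁` vanish. [folklore] -/
theorem af_re_rayleigh_single_eq_zero (L : ℕ) {i : Fin 3} (hi : (i : ℕ) < 2) :
    (star (Pi.single i (1 : ℂ)) ⬝ᵥ afA[L] *ᵥ Pi.single i (1 : ℂ)).re = 0 := by
  rw [af_re_rayleigh]
  fin_cases i
  · simp
  · simp
  · exact absurd hi (by decide)

/-- BALANCED FLOORS, block 1: `minEnergyOn A_L K₁ = 0`. [folklore] -/
theorem af_minEnergyOn_block₁ (L : ℕ) : (afA[L]).minEnergyOn afK₁ = 0 := by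
  refine le_antisymm ?_ ?_
  · have h := minEnergyOn_le_rayleigh_of_mem (af_isHermitian L) afK₁ af_single_mem_K₁ (af_single_unit 0)
    rwa [af_re_rayleigh_single_eq_zero L (i := 0) (by decide)] at h
  · exact aw_le_minEnergyOn _ _ af_single_mem_K₁ (af_single_unit 0) fun ψ _ _ => af_rayleigh_nonneg L ψ

/-- BALANCED FLOORS, block 2: `minEnergyOn A_L K₂ = 0`. [folklore] -/
theorem af_minEnergyOn_block₂ (L : ℕ) : (afA[L]).minEnergyOn afK₂ = 0 := by
  refine le_antisymm ?_ ?_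
  · have h := minEnergyOn_le_rayleigh_of_mem (af_isHermitian L) afK₂ (af_single_mem_K₂ (i := 1) (by decide))
      (af_single_unit 1)
    rwa [af_re_rayleigh_single_eq_zero L (i := 1) (by decide)] at h
  · exact aw_le_minEnergyOn _ _ (af_single_mem_K₂ (i := 1) (by decide)) (af_single_unit 1)
      fun ψ _ _ => af_rayleigh_nonneg L ψ

/-! ### The pair operator: lowering, norm, floor order, locality budget, and the vanishing bridge -/

/-- Action of the toy pair operator: `Δ_L v = L² v₀ e₂`. [folklore] -/
theorem af_pairField_mulVec (L : ℕ) (v : Fin 3 → ℂ) :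
    afΔ[L] *ᵥ v = (((L : ℂ)) ^ 2 * v 0) • Pi.single (2 : Fin 3) (1 : ℂ) :=
  Matrix.single_mulVec_eq _ _ _ _

/-- The toy pair operator lowers block 1 into block 2. [folklore] -/
theorem af_pairField_mulVec_mem_K₂ (L : ℕ) (v : Fin 3 → ℂ) : afΔ[L] *ᵥ v ∈ afK₂ := by
  rw [af_pairField_mulVec]
  exact Submodule.smul_mem _ _ (af_single_mem_K₂ (i := 2) (by decide))

/-- Pair intensity `‖Δ_L v‖² = L⁴ |v 0|²`. [folklore] -/
theorem af_pairField_normSq (L : ℕ) (v : Fin 3 → ℂ) :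
    (star (afΔ[L] *ᵥ v) ⬝ᵥ (afΔ[L] *ᵥ v)).re = (L : ℝ) ^ 4 * ‖v 0‖ ^ 2 := by
  rw [af_pairField_mulVec, star_smul, smul_dotProduct, dotProduct_smul, af_single_unit]
  simp only [smul_eq_mul, mul_one]
  rw [Complex.star_def, Complex.conj_mul', ← Complex.ofReal_pow, Complex.ofReal_re, norm_mul, norm_pow,
    Complex.norm_natCast]
  ring

/-- Norm bound `‖Δ_L v‖² ≤ L⁴ ‖v‖²`. [folklore] -/
theorem af_pairField_norm_le (L : ℕ) (v : Fin 3 → ℂ) :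
    (star (afΔ[L] *ᵥ v) ⬝ᵥ (afΔ[L] *ᵥ v)).re ≤ (L : ℝ) ^ 4 * (star v ⬝ᵥ v).re := by
  rw [af_pairField_normSq, af_re_star_dotProduct_self]
  have h4 : (0 : ℝ) ≤ (L : ℝ) ^ 4 := by positivity
  nlinarith [sq_nonneg ‖v 1‖, sq_nonneg ‖v 2‖, mul_nonneg h4 (add_nonneg (sq_nonneg ‖v 1‖) (sq_nonneg ‖v 2‖))]

/-- FLOOR ORDER: the unit block-1 floor `e₀` (an `A_L`-eigenvector at the block-1 floor energy) has `‖Δ_L e₀‖² = L⁴`.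
[folklore] -/
theorem af_floorOrder (L : ℕ) :
    (Pi.single (0 : Fin 3) (1 : ℂ) : Fin 3 → ℂ) ∈ afK₁ ∧ (Pi.single (0 : Fin 3) (1 : ℂ) : Fin 3 → ℂ) ≠ 0 ∧
      afA[L] *ᵥ (Pi.single (0 : Fin 3) (1 : ℂ)) =
        (((afA[L]).minEnergyOn afK₁ : ℝ) : ℂ) • (Pi.single (0 : Fin 3) (1 : ℂ) : Fin 3 → ℂ) ∧
      star (Pi.single (0 : Fin 3) (1 : ℂ)) ⬝ᵥ Pi.single (0 : Fin 3) (1 : ℂ) = 1 ∧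
      (star (afΔ[L] *ᵥ Pi.single (0 : Fin 3) (1 : ℂ)) ⬝ᵥ (afΔ[L] *ᵥ Pi.single (0 : Fin 3) (1 : ℂ))).re =
        (L : ℝ) ^ 4 := by
  refine ⟨af_single_mem_K₁, ?_, ?_, af_single_unit 0, ?_⟩
  · intro h
    have := congrFun h 0
    simp at this
  · rw [af_minEnergyOn_block₁, Complex.ofReal_zero, zero_smul, af_mulVec]
    ext i
    fin_cases i <;> simp
  · rw [af_pairField_normSq, Pi.single_eq_same, norm_one, one_pow, mul_one]

/-- KOMA–TASAKI LOCALITY BUDGET (the model input of `bridgeFromFloorOrder`): the pair image of any block-1 vector has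
excess energy above the block-2 floor `e₂ = 0` bounded by `L² ‖g‖²` — here `Re⟨Δ_L g, A_L Δ_L g⟩ = L⁻² · L⁴ |g 0|²`. [folklore] -/
theorem af_ktBudget (L : ℕ) [NeZero L] (g : Fin 3 → ℂ) :
    (star (afΔ[L] *ᵥ g) ⬝ᵥ afA[L] *ᵥ (afΔ[L] *ᵥ g)).re -
        (afA[L]).minEnergyOn afK₂ * (star (afΔ[L] *ᵥ g) ⬝ᵥ (afΔ[L] *ᵥ g)).re ≤
      (L : ℝ) ^ 2 * (star g ⬝ᵥ g).re := by
  rw [af_minEnergyOn_block₂, zero_mul, sub_zero, af_re_rayleigh, af_re_star_dotProduct_self]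
  have h2 : ‖(afΔ[L] *ᵥ g) 2‖ ^ 2 = (L : ℝ) ^ 4 * ‖g 0‖ ^ 2 := by
    rw [af_pairField_mulVec, Pi.smul_apply, Pi.single_eq_same, smul_eq_mul, mul_one, norm_mul, norm_pow,
      Complex.norm_natCast]
    ring
  have hL : (L : ℝ) ≠ 0 := Nat.cast_ne_zero.2 (NeZero.ne L)
  rw [h2, ← mul_assoc, show ((L : ℝ) ^ 2)⁻¹ * (L : ℝ) ^ 4 = (L : ℝ) ^ 2 by field_simp]
  have : (0 : ℝ) ≤ (L : ℝ) ^ 2 := by positivity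
  nlinarith [sq_nonneg ‖g 1‖, sq_nonneg ‖g 2‖, mul_nonneg this (add_nonneg (sq_nonneg ‖g 1‖) (sq_nonneg ‖g 2‖))]

/-- THE VANISHING BRIDGE: every block-2 floor vector `χ` (a block-2 eigenvector of `A_L` at the block-2 floor energy) is
orthogonal to the pair image of EVERY vector `φ`: `⟨χ, Δ_L φ⟩ = 0` — `Δ_L φ ∝ e₂` sits at the excited level `L⁻²` (a tower
collision at the Koma–Tasaki scale). [folklore] -/
theorem af_bridge_eq_zero (L : ℕ) [NeZero L] {χ : Fin 3 → ℂ}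
    (hAχ : afA[L] *ᵥ χ = (((afA[L]).minEnergyOn afK₂ : ℝ) : ℂ) • χ) (φ : Fin 3 → ℂ) :
    star χ ⬝ᵥ (afΔ[L] *ᵥ φ) = 0 := by
  rw [af_minEnergyOn_block₂, Complex.ofReal_zero, zero_smul, af_mulVec] at hAχ
  have hL : (((L : ℂ)) ^ 2)⁻¹ ≠ 0 := inv_ne_zero (pow_ne_zero 2 (Nat.cast_ne_zero.2 (NeZero.ne L)))
  have h2 : χ 2 = 0 := by
    have := congrFun hAχ 2
    simp only [Matrix.cons_val_two, Matrix.tail_cons, Matrix.head_cons, Pi.zero_apply, mul_eq_zero] at this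
    exact this.resolve_left hL
  rw [af_pairField_mulVec, dotProduct_smul, dotProduct_single, Pi.star_apply, h2, star_zero, zero_mul, smul_zero]

/-! ### The window double: the crux's gain hypothesis holds as well -/

/-- **Linear Josephson gain of the toy window double**: for `J ≥ 0` and `L ≥ 1`, `J L² − L⁻² ≤ E_L(0) − E_L(J)`
(tree `stub_gainAbstract` with the pair `(e₀, e₂)`: `|⟨e₂, D e₀⟩|² = L²`, excesses `0` and `L⁻²`). [folklore] -/
theorem af_gain (L : ℕ) [NeZero L] {J : ℝ} (hJ : 0 ≤ J) :
    (let D : Matrix (Fin 3) (Fin 3) ℂ := ((L : ℂ))⁻¹ • afΔ[L]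
     let Hd : ℝ → Matrix (Fin 3 × Fin 3) (Fin 3 × Fin 3) ℂ := fun J =>
       Matrix.kroneckerMap (fun a b : ℂ => a * b) afA[L] 1 +
         Matrix.kroneckerMap (fun a b : ℂ => a * b) 1 (Matrix.transpose afA[L]) -
         (J : ℂ) • (Matrix.kroneckerMap (fun a b : ℂ => a * b) D (Matrix.transpose (Matrix.conjTranspose D)) +
           Matrix.kroneckerMap (fun a b : ℂ => a * b) (Matrix.conjTranspose D) (Matrix.transpose D))
     let good : Fin 3 × Fin 3 → Prop := fun p =>
       ((p.1 : ℕ) < 1 ∧ (p.2 : ℕ) < 1) ∨ (1 ≤ (p.1 : ℕ) ∧ 1 ≤ (p.2 : ℕ))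
     let S : Submodule ℂ (Fin 3 × Fin 3 → ℂ) := ⨅ (p : Fin 3 × Fin 3) (_ : ¬ good p),
       LinearMap.ker (LinearMap.proj (R := ℂ) (φ := fun _ : Fin 3 × Fin 3 => ℂ) p)
     let E : ℝ → ℝ := fun J => (Hd J).minEnergyOn S
     J * (L : ℝ) ^ 2 - ((L : ℝ) ^ 2)⁻¹ ≤ E 0 - E J) := by
  intro D Hd good S E
  have hS : ∀ ψ, ψ ∈ S ↔ ∀ p, ¬ good p → ψ p = 0 := by
    intro ψ
    simp only [S, Submodule.mem_iInf, LinearMap.mem_ker, LinearMap.proj_apply]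
  have h12 : ∀ s : Fin 3, (s : ℕ) < 1 → ¬ 1 ≤ (s : ℕ) := fun s hs => by omega
  have hgood : ∀ s t : Fin 3, good (s, t) → ((s : ℕ) < 1 ∧ (t : ℕ) < 1) ∨ (1 ≤ (s : ℕ) ∧ 1 ≤ (t : ℕ)) :=
    fun s t h => h
  have hgood₁ : ∀ s t : Fin 3, (s : ℕ) < 1 → (t : ℕ) < 1 → good (s, t) := fun s t hs ht => Or.inl ⟨hs, ht⟩
  have hgood₂ : ∀ s t : Fin 3, 1 ≤ (s : ℕ) → 1 ≤ (t : ℕ) → good (s, t) := fun s t hs ht => Or.inr ⟨hs, ht⟩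
  have hA₁ : ∀ v : Fin 3 → ℂ, (∀ s : Fin 3, ¬ (s : ℕ) < 1 → v s = 0) →
      (0 : ℝ) * (star v ⬝ᵥ v).re ≤ (star v ⬝ᵥ (afA[L]).mulVec v).re := fun v _ => by
    rw [zero_mul]; exact af_rayleigh_nonneg L v
  have hA₂ : ∀ v : Fin 3 → ℂ, (∀ s : Fin 3, ¬ 1 ≤ (s : ℕ) → v s = 0) →
      (0 : ℝ) * (star v ⬝ᵥ v).re ≤ (star v ⬝ᵥ (afA[L]).mulVec v).re := fun v _ => by
    rw [zero_mul]; exact af_rayleigh_nonneg L v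
  have huP : ∀ s : Fin 3, ¬ (s : ℕ) < 1 → (Pi.single (0 : Fin 3) (1 : ℂ) : Fin 3 → ℂ) s = 0 :=
    (af_mem_K₁ _).1 af_single_mem_K₁
  have hwP : ∀ s : Fin 3, ¬ 1 ≤ (s : ℕ) → (Pi.single (2 : Fin 3) (1 : ℂ) : Fin 3 → ℂ) s = 0 :=
    (af_mem_K₂ _).1 (af_single_mem_K₂ (i := 2) (by decide))
  have key := stub_gainAbstract afA[L] D (af_isHermitian L) (fun s : Fin 3 => (s : ℕ) < 1) (fun s : Fin 3 => 1 ≤ (s : ℕ))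
    h12 good hgood hgood₁ hgood₂ S hS 0 hA₁ hA₂ (Pi.single (0 : Fin 3) (1 : ℂ)) (Pi.single (2 : Fin 3) (1 : ℂ)) huP hwP
    (af_single_unit 0) (af_single_unit 2) hJ
  have hL : (L : ℂ) ≠ 0 := Nat.cast_ne_zero.2 (NeZero.ne L)
  have hmat : star (Pi.single (2 : Fin 3) (1 : ℂ)) ⬝ᵥ D.mulVec (Pi.single (0 : Fin 3) (1 : ℂ)) = (L : ℂ) := by
    show star (Pi.single (2 : Fin 3) (1 : ℂ)) ⬝ᵥ ((((L : ℂ))⁻¹ • afΔ[L]) *ᵥ Pi.single (0 : Fin 3) (1 : ℂ)) = (L : ℂ)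
    rw [smul_mulVec, af_pairField_mulVec, Pi.single_eq_same, mul_one, dotProduct_smul, dotProduct_smul,
      af_single_unit]
    simp only [smul_eq_mul, mul_one]
    field_simp
  have hu : (star (Pi.single (0 : Fin 3) (1 : ℂ)) ⬝ᵥ (afA[L]).mulVec (Pi.single (0 : Fin 3) (1 : ℂ))).re = 0 :=
    af_re_rayleigh_single_eq_zero L (i := 0) (by decide)
  have hw : (star (Pi.single (2 : Fin 3) (1 : ℂ)) ⬝ᵥ (afA[L]).mulVec (Pi.single (2 : Fin 3) (1 : ℂ))).re =
      ((L : ℝ) ^ 2)⁻¹ := by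
    show (star (Pi.single (2 : Fin 3) (1 : ℂ)) ⬝ᵥ afA[L] *ᵥ (Pi.single (2 : Fin 3) (1 : ℂ))).re = _
    rw [af_re_rayleigh, Pi.single_eq_same, norm_one, one_pow, mul_one]
  rw [hmat, hu, hw, Complex.norm_natCast] at key
  have h2 : J * (L : ℝ) ^ 2 - ((L : ℝ) ^ 2)⁻¹ = J * (L : ℝ) ^ 2 - (0 - 0) - (((L : ℝ) ^ 2)⁻¹ - 0) := by ring
  rw [h2]
  exact key

/-! ### The packaged negative statement for (R2′) -/

/-- **(R2′) `FloorOrderBridges` is false without Hubbard specifics.**  The ABSTRACT FLOOR-ORDER ⇒ FLOOR-BRIDGE principle —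
for an index type with two disjoint blocks, Hermitian block-preserving layer Hamiltonians `A_L` with BALANCED floors,
block-lowering pair operators `Δ_L` with `‖Δ_L v‖² ≤ L⁴‖v‖²` obeying the Koma–Tasaki LOCALITY BUDGET
`Re⟨Δ_L g, A_L Δ_L g⟩ − e₂(L) ‖Δ_L g‖² ≤ C L² ‖g‖²` on block 1: "floor order `c L⁴ ≤ ‖Δ_L g‖²` of some unit block-1 floor
vector, eventually in even `L` ⇒ eventually a floor pair `(φ, χ)` with `a' L⁴ ≤ |⟨χ, Δ_L φ⟩|²`" (hypothesis and conclusion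
spelled as `FloorOrder` / `FloorBridge` of the crux's normal form) — is FALSE: the toy `A_L = diag(0, 0, L⁻²)`,
`Δ_L = L²|e₂⟩⟨e₀|` satisfies every hypothesis (`af_floorOrder`, `af_ktBudget` with `C = 1`) while every bridge vanishes
(`af_bridge_eq_zero`).  Hence any proof of (R2′) must use a property of `hubbardTorus 2 L 1 U` failing here — isolation of the
`(N_L − 2, 0)` floor from `Δ_d G(N_L)` at a scale `≫ L⁻²` (the hypothesis of `bridgeFromFloorOrder`, p107506). [folklore] -/
theorem not_abstractFloorOrderBridges :
    ¬ ∀ (ι : Type) [Fintype ι] [DecidableEq ι] (P₁ P₂ : ι → Prop) (A Δ : ℕ → Matrix ι ι ℂ) (C : ℝ),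
        (∀ L, (A L).IsHermitian) → (∀ s, P₁ s → ¬ P₂ s) → 0 ≤ C →
        (let K₁ : Submodule ℂ (ι → ℂ) := ⨅ (s : ι) (_ : ¬ P₁ s),
           LinearMap.ker (LinearMap.proj (R := ℂ) (φ := fun _ : ι => ℂ) s)
         let K₂ : Submodule ℂ (ι → ℂ) := ⨅ (s : ι) (_ : ¬ P₂ s),
           LinearMap.ker (LinearMap.proj (R := ℂ) (φ := fun _ : ι => ℂ) s)
         (∀ L, ∀ v ∈ K₁, A L *ᵥ v ∈ K₁) ∧ (∀ L, ∀ v ∈ K₂, A L *ᵥ v ∈ K₂) ∧ (∀ L, ∀ v ∈ K₁, Δ L *ᵥ v ∈ K₂) ∧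
           (∀ L, (A L).minEnergyOn K₁ = (A L).minEnergyOn K₂) ∧
           (∀ (L : ℕ) (v : ι → ℂ), (star (Δ L *ᵥ v) ⬝ᵥ (Δ L *ᵥ v)).re ≤ (L : ℝ) ^ 4 * (star v ⬝ᵥ v).re) ∧
           (∀ (L : ℕ) [NeZero L], ∀ g ∈ K₁,
              (star (Δ L *ᵥ g) ⬝ᵥ A L *ᵥ (Δ L *ᵥ g)).re -
                  (A L).minEnergyOn K₂ * (star (Δ L *ᵥ g) ⬝ᵥ (Δ L *ᵥ g)).re ≤
                C * (L : ℝ) ^ 2 * (star g ⬝ᵥ g).re)) →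
        (∃ c : ℝ, 0 < c ∧ ∃ L₀ : ℕ, ∀ (L : ℕ) [NeZero L], Even L → L₀ ≤ L →
          ∃ g : ι → ℂ,
            (let K₁ : Submodule ℂ (ι → ℂ) := ⨅ (s : ι) (_ : ¬ P₁ s),
               LinearMap.ker (LinearMap.proj (R := ℂ) (φ := fun _ : ι => ℂ) s)
             g ∈ K₁ ∧ g ≠ 0 ∧ A L *ᵥ g = (((A L).minEnergyOn K₁ : ℝ) : ℂ) • g) ∧ star g ⬝ᵥ g = 1 ∧
            c * (L : ℝ) ^ 4 ≤ (star (Δ L *ᵥ g) ⬝ᵥ (Δ L *ᵥ g)).re) →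
        ∃ a' : ℝ, 0 < a' ∧ ∃ L₀ : ℕ, ∀ (L : ℕ) [NeZero L], Even L → L₀ ≤ L →
          ∃ φ χ : ι → ℂ,
            (let K₁ : Submodule ℂ (ι → ℂ) := ⨅ (s : ι) (_ : ¬ P₁ s),
               LinearMap.ker (LinearMap.proj (R := ℂ) (φ := fun _ : ι => ℂ) s)
             φ ∈ K₁ ∧ φ ≠ 0 ∧ A L *ᵥ φ = (((A L).minEnergyOn K₁ : ℝ) : ℂ) • φ) ∧ star φ ⬝ᵥ φ = 1 ∧
            (let K₂ : Submodule ℂ (ι → ℂ) := ⨅ (s : ι) (_ : ¬ P₂ s),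
               LinearMap.ker (LinearMap.proj (R := ℂ) (φ := fun _ : ι => ℂ) s)
             χ ∈ K₂ ∧ χ ≠ 0 ∧ A L *ᵥ χ = (((A L).minEnergyOn K₂ : ℝ) : ℂ) • χ) ∧ star χ ⬝ᵥ χ = 1 ∧
            a' * (L : ℝ) ^ 4 ≤ ‖star χ ⬝ᵥ (Δ L *ᵥ φ)‖ ^ 2 := by
  intro h
  have hstruct : (∀ L, ∀ v ∈ afK₁, afA[L] *ᵥ v ∈ afK₁) ∧ (∀ L, ∀ v ∈ afK₂, afA[L] *ᵥ v ∈ afK₂) ∧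
      (∀ L, ∀ v ∈ afK₁, afΔ[L] *ᵥ v ∈ afK₂) ∧ (∀ L, (afA[L]).minEnergyOn afK₁ = (afA[L]).minEnergyOn afK₂) ∧
      (∀ (L : ℕ) (v : Fin 3 → ℂ), (star (afΔ[L] *ᵥ v) ⬝ᵥ (afΔ[L] *ᵥ v)).re ≤ (L : ℝ) ^ 4 * (star v ⬝ᵥ v).re) ∧
      (∀ (L : ℕ) [NeZero L], ∀ g ∈ afK₁,
        (star (afΔ[L] *ᵥ g) ⬝ᵥ afA[L] *ᵥ (afΔ[L] *ᵥ g)).re -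
            (afA[L]).minEnergyOn afK₂ * (star (afΔ[L] *ᵥ g) ⬝ᵥ (afΔ[L] *ᵥ g)).re ≤
          (1 : ℝ) * (L : ℝ) ^ 2 * (star g ⬝ᵥ g).re) :=
    ⟨fun L v hv => af_mulVec_mem_K₁ L hv, fun L v _ => af_mulVec_mem_K₂ L v, fun L v _ => af_pairField_mulVec_mem_K₂ L v,
      fun L => by rw [af_minEnergyOn_block₁, af_minEnergyOn_block₂], af_pairField_norm_le,
      fun L _ g _ => by rw [one_mul]; exact af_ktBudget L g⟩
  have horder : ∃ c : ℝ, 0 < c ∧ ∃ L₀ : ℕ, ∀ (L : ℕ) [NeZero L], Even L → L₀ ≤ L →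
      ∃ g : Fin 3 → ℂ, (g ∈ afK₁ ∧ g ≠ 0 ∧ afA[L] *ᵥ g = (((afA[L]).minEnergyOn afK₁ : ℝ) : ℂ) • g) ∧
        star g ⬝ᵥ g = 1 ∧ c * (L : ℝ) ^ 4 ≤ (star (afΔ[L] *ᵥ g) ⬝ᵥ (afΔ[L] *ᵥ g)).re := by
    refine ⟨1, one_pos, 0, fun L _ _ _ => ⟨Pi.single (0 : Fin 3) (1 : ℂ), ?_⟩⟩
    obtain ⟨h1, h2, h3, h4, h5⟩ := af_floorOrder L
    exact ⟨⟨h1, h2, h3⟩, h4, by rw [h5, one_mul]⟩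
  obtain ⟨a', ha', L₀, hL₀⟩ := h (Fin 3) (fun s : Fin 3 => (s : ℕ) < 1) (fun s : Fin 3 => 1 ≤ (s : ℕ))
    (fun L => afA[L]) (fun L => afΔ[L]) 1 af_isHermitian (fun s hs => by omega) zero_le_one hstruct horder
  haveI : NeZero (2 * L₀ + 2) := ⟨by omega⟩
  obtain ⟨φ, χ, -, -, ⟨-, -, hAχ⟩, -, hbridge⟩ := hL₀ (2 * L₀ + 2) ⟨L₀ + 1, by ring⟩ (by omega)
  rw [af_bridge_eq_zero (2 * L₀ + 2) hAχ φ, norm_zero, zero_pow two_ne_zero] at hbridge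
  have : (0 : ℝ) < a' * ((2 * L₀ + 2 : ℕ) : ℝ) ^ 4 := by positivity
  linarith

end Summit.HubbardSuperconductivity.JmInterchangeNegative

end
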